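import Literature.Analysis.FluidPDE.TaoCascadeZeroScalePhase
import Literature.Analysis.FluidPDE.TaoCascadeZeroScaleGrowth
import HarnessLib

/-!
# Tao's cascade ODE, §6.7: `b₀` and `c₀` on an interval — affine bounds for `b₀`, exponential two-sided bounds for `c₀`

T. Tao, *Finite time blowup for an averaged three-dimensional Navier–Stokes equation*,
J. Amer. Math. Soc. **29** (2016), 601–674 = arXiv:1402.0290v3, §6.7: (6.157) (`b₀` is affine in `t`
up to `t_c`), (6.162)–(6.163) ("`∂ₜb₀ ≥ -O(ε³exp(O(K^{10})))` … `b₀(t) ≥ 10⁻⁴ε` … `|∂ₜb₀| ≤ 10ε` …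
`|b₀| ≤ 10⁴ε`"), (6.163)–(6.167) ("`c₀(t) ≥ K^{-10}ε²` … `∂ₜc₀ ≳ K^{10}c₀` … `c₀ ≥ K^{100}ε²` on `I`
… `∂ₜc₀ ≲ K^{10}c₀` … `c₀ ≲ exp(O(K^{10-1/2}))ε²`") and (6.181).

Over `RescaledHypotheses γ …` (`TaoCascadeRescaled.lean`) and on an interval `[t₁, t₂]` with
`t₁ ≥ 0 ≥ τ_{n₀-N}` on which `Ẽ₀ ≤ 1`, this file provides, with explicit constants
(`μ = ε⁻¹K^{10}`, `λ = ε²e^{-K^{10}}`, `η = C₁(1+ε₀)^{-n₀/2}`):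

* `zero_b_upper_on`: `b₀(t) ≤ b₀(t₁) + (ε A² + η)(t-t₁)` when `a₀² ≤ A²`;
* `zero_b_lower_on`: `b₀(t) ≥ b₀(t₁) + (ε A₋ - μ C² - η)(t-t₁)` when `a₀² ≥ A₋`, `|c₀| ≤ C`;
* `zero_c_lower_on`: `c₀(t) ≥ e^{μ b̲ (t-t₁)}(c₀(t₁) - η(t-t₁))` when `b₀ ≥ b̲ ≥ 0` (growth from below);
* `zero_c_upper_on`: `c₀(t) ≤ e^{μ b̄ (t-t₁)}(c₀(t₁) + (λA² + η)(t-t₁))` when `b₀ ≤ b̄`, `b̄ ≥ 0`,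
  `c₀(t₁) ≥ 0`;
* `zero_c_deriv_bounds`: pointwise `μ b₀ c₀ - η ≤ ∂ₜc₀ ≤ λ A² + μ b₀ c₀ + η`.

Tools: `eq_b_zero`, `eq_c_zero` (`TaoCascadeFiveModes.lean`), `exp_growth_lower`, `le_exp_growth`
(`TaoCascadeZeroScaleGrowth.lean`), and the one-sided integration lemmas of
`Literature/Analysis/ODE/LinearComparison.lean`.

## References

* T. Tao, J. Amer. Math. Soc. 29 (2016), 601–674, arXiv:1402.0290v3, §6.7 (6.157), (6.162)–(6.167),
  (6.181). [`Tao2016AveragedNS`]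
-/

noncomputable section

open Set MeasureTheory intervalIntegral

namespace Literature.Analysis.FluidPDE

namespace TaoCascade

open Literature.Analysis.ODE

section RotorPhase

variable {γ ε₀ K ε C₁ C₂ C₃ : ℝ} {n₀ N : ℤ} {τ : ℤ → ℝ} {Xr : Fin 4 → ℤ → ℝ → ℝ} {Er : ℤ → ℝ → ℝ}

/-- **Pointwise two-sided bounds for `∂ₜc₀`** ((6.164), (6.166), (6.181)): at `t ≥ τ_{n₀-N}` with
`Ẽ₀(t) ≤ 1` and `a₀(t)² ≤ A²`:
`ε⁻¹K^{10}b₀c₀ - η ≤ ∂ₜc₀ ≤ ε²e^{-K^{10}}A² + ε⁻¹K^{10}b₀c₀ + η`, `η = C₁(1+ε₀)^{-n₀/2}`.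
[cite: Tao2016AveragedNS, §6.7 (6.164), (6.166), (6.181)] -/
theorem RescaledHypotheses.zero_c_deriv_bounds
    (h : RescaledHypotheses γ ε₀ K ε C₁ C₂ C₃ n₀ N τ Xr Er) (hC₁ : 0 ≤ C₁) (hε₀ : 0 < ε₀)
    {t A : ℝ} (ht : τ (n₀ - N) ≤ t) (hE0 : Er 0 t ≤ 1) (hA : Xr 0 0 t ^ 2 ≤ A ^ 2) :
    ε⁻¹ * K ^ 10 * Xr 1 0 t * Xr 2 0 t - C₁ * (1 + ε₀) ^ (-((n₀ : ℝ) / 2)) ≤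
        derivWithin (Xr 2 0) (Ici (τ (n₀ - N))) t ∧
      derivWithin (Xr 2 0) (Ici (τ (n₀ - N))) t ≤
        ε ^ 2 * Real.exp (-K ^ 10) * A ^ 2 + ε⁻¹ * K ^ 10 * Xr 1 0 t * Xr 2 0 t +
          C₁ * (1 + ε₀) ^ (-((n₀ : ℝ) / 2)) := by
  have he := abs_le.mp (h.eq_c_zero hC₁ (by linarith) ht hE0)
  have hsrc0 : 0 ≤ ε ^ 2 * Real.exp (-K ^ 10) * Xr 0 0 t ^ 2 := by positivity
  have hsrc1 : ε ^ 2 * Real.exp (-K ^ 10) * Xr 0 0 t ^ 2 ≤ ε ^ 2 * Real.exp (-K ^ 10) * A ^ 2 :=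
    mul_le_mul_of_nonneg_left hA (by positivity)
  constructor <;> linarith [he.1, he.2]

/-- **`b₀` grows at most affinely** ((6.157), (6.163)): on `[t₁, t₂]` (`0 ≤ t₁`) with `Ẽ₀ ≤ 1`
and `a₀² ≤ A²` there, `b₀(t) ≤ b₀(t₁) + (ε A² + η)(t - t₁)` (`ε ≥ 0`).
[cite: Tao2016AveragedNS, §6.7 (6.157), (6.163)] -/
theorem RescaledHypotheses.zero_b_upper_on
    (h : RescaledHypotheses γ ε₀ K ε C₁ C₂ C₃ n₀ N τ Xr Er) (hε : 0 ≤ ε) (hC₁ : 0 ≤ C₁)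
    (hε₀ : 0 < ε₀) {t₁ t₂ A : ℝ} (hτ : τ (n₀ - N) ≤ t₁)
    (hreg : ∀ t ∈ Icc t₁ t₂, Er 0 t ≤ 1) (hA : ∀ t ∈ Icc t₁ t₂, Xr 0 0 t ^ 2 ≤ A ^ 2)
    {t : ℝ} (ht : t ∈ Icc t₁ t₂) :
    Xr 1 0 t ≤ Xr 1 0 t₁ + (ε * A ^ 2 + C₁ * (1 + ε₀) ^ (-((n₀ : ℝ) / 2))) * (t - t₁) := by
  have hb := le_add_integral_of_deriv_right_le (h.continuousOn_X 1 0 hτ)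
    (fun s hs => h.hasDeriv_X 1 0 (hτ.trans hs.1))
    (A := fun _ => ε * A ^ 2 + C₁ * (1 + ε₀) ^ (-((n₀ : ℝ) / 2))) continuousOn_const ?_ ht (b := t₂)
  · have hI : ∫ s in t₁..t, (fun _ : ℝ => ε * A ^ 2 + C₁ * (1 + ε₀) ^ (-((n₀ : ℝ) / 2))) s =
        (ε * A ^ 2 + C₁ * (1 + ε₀) ^ (-((n₀ : ℝ) / 2))) * (t - t₁) := by
      simp only [intervalIntegral.integral_const, smul_eq_mul]; ring
    rw [hI] at hb; exact hb
  · intro s hs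
    have hs' : s ∈ Icc t₁ t₂ := Ico_subset_Icc_self hs
    have he := (abs_le.mp (h.eq_b_zero hC₁ (by linarith) (hτ.trans hs.1) (hreg s hs'))).2
    have hneg : 0 ≤ ε⁻¹ * K ^ 10 * Xr 2 0 s ^ 2 := by
      have : 0 ≤ ε⁻¹ := inv_nonneg.2 hε
      positivity
    have hpos : ε * Xr 0 0 s ^ 2 ≤ ε * A ^ 2 := mul_le_mul_of_nonneg_left (hA s hs') hε
    show derivWithin (Xr 1 0) (Ici (τ (n₀ - N))) s ≤ _
    linarith

/-- **`b₀` decreases at most affinely** ((6.157), (6.162)): on `[t₁, t₂]` with `Ẽ₀ ≤ 1`,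
`a₀² ≥ A₋` and `|c₀| ≤ C` there, `b₀(t) ≥ b₀(t₁) + (ε A₋ - ε⁻¹K^{10} C² - η)(t - t₁)` (`ε ≥ 0`).
[cite: Tao2016AveragedNS, §6.7 (6.157), (6.162)] -/
theorem RescaledHypotheses.zero_b_lower_on
    (h : RescaledHypotheses γ ε₀ K ε C₁ C₂ C₃ n₀ N τ Xr Er) (hε : 0 ≤ ε) (hC₁ : 0 ≤ C₁)
    (hε₀ : 0 < ε₀) {t₁ t₂ Alo C : ℝ} (hτ : τ (n₀ - N) ≤ t₁)
    (hreg : ∀ t ∈ Icc t₁ t₂, Er 0 t ≤ 1) (hA : ∀ t ∈ Icc t₁ t₂, Alo ≤ Xr 0 0 t ^ 2)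
    (hc : ∀ t ∈ Icc t₁ t₂, |Xr 2 0 t| ≤ C) {t : ℝ} (ht : t ∈ Icc t₁ t₂) :
    Xr 1 0 t₁ + (ε * Alo - ε⁻¹ * K ^ 10 * C ^ 2 - C₁ * (1 + ε₀) ^ (-((n₀ : ℝ) / 2))) * (t - t₁) ≤
      Xr 1 0 t := by
  have hb := add_integral_le_of_le_deriv_right (h.continuousOn_X 1 0 hτ)
    (fun s hs => h.hasDeriv_X 1 0 (hτ.trans hs.1))
    (A := fun _ => ε * Alo - ε⁻¹ * K ^ 10 * C ^ 2 - C₁ * (1 + ε₀) ^ (-((n₀ : ℝ) / 2)))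
    continuousOn_const ?_ ht (b := t₂)
  · have hI : ∫ s in t₁..t, (fun _ : ℝ => ε * Alo - ε⁻¹ * K ^ 10 * C ^ 2 -
        C₁ * (1 + ε₀) ^ (-((n₀ : ℝ) / 2))) s =
        (ε * Alo - ε⁻¹ * K ^ 10 * C ^ 2 - C₁ * (1 + ε₀) ^ (-((n₀ : ℝ) / 2))) * (t - t₁) := by
      simp only [intervalIntegral.integral_const, smul_eq_mul]; ring
    rw [hI] at hb; exact hb
  · intro s hs
    have hs' : s ∈ Icc t₁ t₂ := Ico_subset_Icc_self hs
    have he := (abs_le.mp (h.eq_b_zero hC₁ (by linarith) (hτ.trans hs.1) (hreg s hs'))).1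
    have hcs := hc s hs'
    have hsq : Xr 2 0 s ^ 2 ≤ C ^ 2 := by
      rw [← sq_abs]; exact pow_le_pow_left₀ (abs_nonneg _) hcs 2
    have hneg : ε⁻¹ * K ^ 10 * Xr 2 0 s ^ 2 ≤ ε⁻¹ * K ^ 10 * C ^ 2 := by
      have : 0 ≤ ε⁻¹ := inv_nonneg.2 hε
      exact mul_le_mul_of_nonneg_left hsq (by positivity)
    have hpos : ε * Alo ≤ ε * Xr 0 0 s ^ 2 := mul_le_mul_of_nonneg_left (hA s hs') hε
    show _ ≤ derivWithin (Xr 1 0) (Ici (τ (n₀ - N))) s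
    linarith

/-- **Exponential growth of `c₀` from below** ((6.163)–(6.165)): on `[t₁, t₂]` with `Ẽ₀ ≤ 1` and
`b₀ ≥ b̲ ≥ 0` there, and `c₀(t₁) ≥ η(t - t₁)`:
`c₀(t) ≥ e^{ε⁻¹K^{10}b̲(t-t₁)}(c₀(t₁) - η(t-t₁))` (`ε ≥ 0`, `η = C₁(1+ε₀)^{-n₀/2}`).
[cite: Tao2016AveragedNS, §6.7 (6.163)–(6.165)] -/
theorem RescaledHypotheses.zero_c_lower_on
    (h : RescaledHypotheses γ ε₀ K ε C₁ C₂ C₃ n₀ N τ Xr Er) (hε : 0 ≤ ε) (hC₁ : 0 ≤ C₁)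
    (hε₀ : 0 < ε₀) {t₁ t₂ blo : ℝ} (hτ : τ (n₀ - N) ≤ t₁) (hblo : 0 ≤ blo)
    (hreg : ∀ t ∈ Icc t₁ t₂, Er 0 t ≤ 1) (hb : ∀ t ∈ Icc t₁ t₂, blo ≤ Xr 1 0 t)
    {t : ℝ} (ht : t ∈ Icc t₁ t₂)
    (hc0 : C₁ * (1 + ε₀) ^ (-((n₀ : ℝ) / 2)) * (t - t₁) ≤ Xr 2 0 t₁) :
    Real.exp (ε⁻¹ * K ^ 10 * blo * (t - t₁)) *
        (Xr 2 0 t₁ - C₁ * (1 + ε₀) ^ (-((n₀ : ℝ) / 2)) * (t - t₁)) ≤ Xr 2 0 t := by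
  have hq0 : (0 : ℝ) < 1 + ε₀ := by linarith
  have hη : 0 ≤ C₁ * (1 + ε₀) ^ (-((n₀ : ℝ) / 2)) := mul_nonneg hC₁ (Real.rpow_nonneg hq0.le _)
  have hμ : 0 ≤ ε⁻¹ * K ^ 10 := by have : 0 ≤ ε⁻¹ := inv_nonneg.2 hε; positivity
  have hβc : ContinuousOn (fun s => ε⁻¹ * K ^ 10 * Xr 1 0 s) (Icc t₁ t₂) :=
    continuousOn_const.mul (h.continuousOn_X 1 0 hτ)
  refine exp_growth_lower (h.continuousOn_X 2 0 hτ) (fun s hs => h.hasDeriv_X 2 0 (hτ.trans hs.1))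
    hβc (mul_nonneg hμ hblo) (fun s hs => mul_le_mul_of_nonneg_left (hb s hs) hμ) hη ?_ ht hc0
  intro s hs
  have hs' : s ∈ Icc t₁ t₂ := Ico_subset_Icc_self hs
  have hsq := h.sq_le_two_mul_energy 0 0 (hτ.trans hs.1) (t := s)
  have hd := (h.zero_c_deriv_bounds hC₁ hε₀ (hτ.trans hs.1) (hreg s hs') (A := Xr 0 0 s) le_rfl).1
  show _ ≤ derivWithin (Xr 2 0) (Ici (τ (n₀ - N))) s
  linarith

/-- **Exponential bound for `c₀` from above** ((6.166)–(6.167)): on `[t₁, t₂]` with `Ẽ₀ ≤ 1`,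
`a₀² ≤ A²`, `b₀ ≤ b̄` with `b̄ ≥ 0` there, and `c₀(t₁) ≥ 0`:
`c₀(t) ≤ e^{ε⁻¹K^{10}b̄(t-t₁)}(c₀(t₁) + (ε²e^{-K^{10}}A² + η)(t-t₁))` (`ε ≥ 0`).
[cite: Tao2016AveragedNS, §6.7 (6.166)–(6.167)] -/
theorem RescaledHypotheses.zero_c_upper_on
    (h : RescaledHypotheses γ ε₀ K ε C₁ C₂ C₃ n₀ N τ Xr Er) (hε : 0 ≤ ε) (hC₁ : 0 ≤ C₁)
    (hε₀ : 0 < ε₀) {t₁ t₂ A bhi : ℝ} (hτ : τ (n₀ - N) ≤ t₁) (hbhi : 0 ≤ bhi)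
    (hreg : ∀ t ∈ Icc t₁ t₂, Er 0 t ≤ 1) (hA : ∀ t ∈ Icc t₁ t₂, Xr 0 0 t ^ 2 ≤ A ^ 2)
    (hb : ∀ t ∈ Icc t₁ t₂, Xr 1 0 t ≤ bhi) (hc : ∀ t ∈ Icc t₁ t₂, 0 ≤ Xr 2 0 t)
    {t : ℝ} (ht : t ∈ Icc t₁ t₂) :
    Xr 2 0 t ≤ Real.exp (ε⁻¹ * K ^ 10 * bhi * (t - t₁)) *
      (Xr 2 0 t₁ + (ε ^ 2 * Real.exp (-K ^ 10) * A ^ 2 + C₁ * (1 + ε₀) ^ (-((n₀ : ℝ) / 2))) * (t - t₁)) := by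
  have hq0 : (0 : ℝ) < 1 + ε₀ := by linarith
  have hη : 0 ≤ C₁ * (1 + ε₀) ^ (-((n₀ : ℝ) / 2)) := mul_nonneg hC₁ (Real.rpow_nonneg hq0.le _)
  have hμ : 0 ≤ ε⁻¹ * K ^ 10 := by have : 0 ≤ ε⁻¹ := inv_nonneg.2 hε; positivity
  have hβc : ContinuousOn (fun s => ε⁻¹ * K ^ 10 * Xr 1 0 s) (Icc t₁ t₂) :=
    continuousOn_const.mul (h.continuousOn_X 1 0 hτ)
  have hg := le_exp_growth (h.continuousOn_X 2 0 hτ) (fun s hs => h.hasDeriv_X 2 0 (hτ.trans hs.1))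
    hβc (mul_nonneg hμ hbhi) (fun s hs => mul_le_mul_of_nonneg_left (hb s hs) hμ)
    (r := fun _ => ε ^ 2 * Real.exp (-K ^ 10) * A ^ 2 + C₁ * (1 + ε₀) ^ (-((n₀ : ℝ) / 2)))
    continuousOn_const (fun s _ => by positivity) ?_ ht (hc t₁ ⟨le_rfl, ht.1.trans ht.2⟩)
  · have hI : ∫ s in t₁..t, (fun _ : ℝ => ε ^ 2 * Real.exp (-K ^ 10) * A ^ 2 +
        C₁ * (1 + ε₀) ^ (-((n₀ : ℝ) / 2))) s =
        (ε ^ 2 * Real.exp (-K ^ 10) * A ^ 2 + C₁ * (1 + ε₀) ^ (-((n₀ : ℝ) / 2))) * (t - t₁) := by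
      simp only [intervalIntegral.integral_const, smul_eq_mul]; ring
    rw [hI] at hg; exact hg
  · intro s hs
    have hs' : s ∈ Icc t₁ t₂ := Ico_subset_Icc_self hs
    have hd := (h.zero_c_deriv_bounds hC₁ hε₀ (hτ.trans hs.1) (hreg s hs') (hA s hs')).2
    -- `μ b₀ c₀ ≤ μ bhi c₀` since `c₀ ≥ 0`
    have hrate : ε⁻¹ * K ^ 10 * Xr 1 0 s * Xr 2 0 s ≤ ε⁻¹ * K ^ 10 * bhi * Xr 2 0 s := by
      apply mul_le_mul_of_nonneg_right _ (hc s hs')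
      exact mul_le_mul_of_nonneg_left (hb s hs') hμ
    show derivWithin (Xr 2 0) (Ici (τ (n₀ - N))) s ≤ _
    linarith

end RotorPhase

end TaoCascade

end Literature.Analysis.FluidPDE
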